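import Summits.ValiantsHypothesis.ValiantsHypothesis.Theorems.LacunarySymmetroidMatrixDescartesPivotRankOneFourKillSeven

/-!
# `MatrixDescartes` census — rank-one `(2,4)₁`, ONE letter below / THREE above: `Z₊ ≤ 8` in chamber (C) under each of the
# three kill-seven conditions (T₀₃), (T₀₁), (T₁₂) (Descartes-with-parity allows NINE there)

HONEST FRAMING.  Object-search cell `pub-symmetroid`, seat `val-sym-mdr-p1` (generation 14); helper file `--supports` the crux item
stmt-ValiantsHypothesis-18050 (`Theses.LacunarySymmetroid.MatrixDescartes`, OPEN, on HOLD) with NO closure claim.  Continues the seat's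
generation-12/13 programme on the `m = 2` pivot column: the rank-one law «`(2,4)₁ ≤ 8`» is open exactly in chambers (A), (B) of the split
`d₀ < d₁ < e < d₂ < d₃` (Descartes `10`; kill-seven theorems `…PivotRankOneFourKillSeven{,Prime,Pairs,Bottom}`) and in chamber (C)
`e+d₀ < d₀+d₁ < 2e < d₀+d₂ < e+d₁ < d₀+d₃ < e+d₂ < d₁+d₂ < e+d₃ < d₁+d₃ < d₂+d₃` of the split `d₀ < e < d₁ < d₂ < d₃` and its mirror
(Descartes-with-parity `9`; `…PivotRankOneReductionOneThree` gives `≤ 7` everywhere else in that split).  THIS FILE lands, for the split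
`d₀ < e < d₁ < d₂ < d₃`, the three weight-free kill-seven conditions that the located census (generation 13, `coverC.py`) found to
cover chamber (C) most often, each as a kernel theorem «condition ⇒ `Z₊ ≤ 8`» (engine: `card_posRoots_le_kills` +
`card_posRoots_fourNomial_le_one` of `…PivotTwoDirectionsBlockLaw`; eleven-nomial `det_rankOne_four_sum`):

* **(T₀₃)** — keep `{e+d₀, 2e, d₀+d₃, e+d₃}` (`= {d₀, e} + {e, d₃}`), kill the other seven degrees: the killed eleven-nomial is
  `A X^{e+d₀} − B X^{2e} + C X^{d₀+d₃} − D X^{e+d₃}` with `B = |det J|·Π`, `D = w₃|m₃|·Π`, and (T₀₃) is the cross-ratio hypothesis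
  `|det J|·Δ₀₃²·Π_B Π_C ≤ m₀ m₃·Π_A Π_D`; in `t`-coordinates (`J ≅ [[0,1],[1,0]]`, `vₖ = (1,tₖ)`, `mₖ = −2tₖ`) it reads
  `σ₀₃ ≤ 4·Π_AΠ_D/(Π_BΠ_C)` with the hyperbolic chord `σₖₗ = (tₖ−tₗ)²/(tₖtₗ)`: letters `0` and `3` CLOSE in angle
  (`elevenNomial_oneThree_T03_le_eight`, matrix form `oneThree_rankOne_posRoots_le_eight_of_T03`; needs `det J < 0`, `m₃ < 0`,
  `w₀, w₃ > 0`; exponent hypotheses `d₀+d₁ < 2e < d₀+d₂`, `d₁+d₂ < e+d₃` only).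
* **(T₀₁)** — keep `{e+d₀, d₀+d₁, 2e, e+d₁}` (`= {d₀, e} + {e, d₁}`): condition `|det J|·Δ₀₁²·Π_BΠ_C ≤ m₀m₁·Π_AΠ_D`, i.e.
  `σ₀₁ ≤ 4·Π_AΠ_D/(Π_BΠ_C)` (letters `0`, `1` close); `det J` ARBITRARY (for `det J ≥ 0` the condition is void), needs `m₁ < 0`,
  `Δ₀₁ ≠ 0`, `w₀, w₁ > 0`; exponent hypotheses `d₀+d₂ < e+d₁ < d₀+d₃` only (`elevenNomial_oneThree_T01_le_eight`,
  `oneThree_rankOne_posRoots_le_eight_of_T01`).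
* **(T₁₂)** — keep `{2e, e+d₁, e+d₂, d₁+d₂}` (`= {e, d₁} + {e, d₂}`): condition `m₁m₂·Π_BΠ_C ≤ |det J|·Δ₁₂²·Π_AΠ_D`, i.e.
  `σ₁₂ ≥ 4·Π_BΠ_C/(Π_AΠ_D)` (the same-side letters `1`, `2` FAR apart); `det J` arbitrary, needs `m₁ < 0`, `Δ₁₂ ≠ 0`, `w₁, w₂ > 0`;
  exponent hypotheses `d₀+d₂ < e+d₁ < d₀+d₃ < e+d₂`, `d₁+d₂ < e+d₃` (`elevenNomial_oneThree_T12_le_eight`,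
  `oneThree_rankOne_posRoots_le_eight_of_T12`).

The `Π`'s are the products of the distances from the four surviving degrees to the seven killed ones, spelled out factor by factor
(each factor positive under the stated exponent hypotheses); the weights cancel from every condition.  Each theorem holds on the stated
exponent region, which contains chamber (C); outside (C) the tree already has `≤ 7`.

WHAT IS NOT CLAIMED.  No covering theorem: «rank-one `(2,4)₁ ≤ 8` in chamber (C)» is NOT claimed, and nothing here bears on
`MatrixDescartes` in its window, on `DoorA26` / `DoorA34`, registers / credences, or `VP ≠ VNP`.  Located context (seat memo, hub floats,
pure python ≤ 60 s): with the below-pivot weight `w₀` ELIMINATED exactly (`det F = det F′ + w₀X^{d₀}·uᵀF′u`, `u ⟂ v₀`, so the root count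
at the best `w₀` is the level-set count of `−det F′/(X^{d₀}uᵀF′u)`), random and hill-climbing search over the remaining data met at most
`5` positive roots in the split `d₀ < e < d₁ < d₂ < d₃` (`9` allowed by Descartes-with-parity) and at most `8` in the split
`d₀ < d₁ < e < d₂ < d₃` — located only.

[folklore] The engine of `…PivotTwoDirectionsBlockLaw`; `2 × 2` determinant algebra.  No definitions, no named facts.
-/

-- `Summit.ValiantsHypothesis.ValiantsHypothesis.…` repeats a component by the D-0017 layout
-- (single-conjunct summit), which the `dupNamespace` linter flags; the name is mandated.
set_option linter.dupNamespace false

namespace Summit.ValiantsHypothesis.ValiantsHypothesis.Theorems.LacunarySymmetroidMatrixDescartes.Pivot.TwoDirections.BlockLaw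

open Polynomial Matrix Finset
open scoped BigOperators

/-! ## 1. Condition (T₀₃): letters `0` (below) and `3` (top) close -/

/-- **(T₀₃), real-parameter form.**  The eleven-nomial of the split `d₀ < e < d₁ < d₂ < d₃` with `d₀+d₁ < 2e < d₀+d₂`, `d₁+d₂ < e+d₃`
(`dJ < 0` the pivot determinant, `m₃ < 0` the pairing of letter `3`, `w₀, w₃ > 0`, everything else arbitrary) has at most EIGHT positive
roots under the cross-ratio condition (T₀₃) (kept degrees `e+d₀, 2e, d₀+d₃, e+d₃`). -/
theorem elevenNomial_oneThree_T03_le_eight (e d₀ d₁ d₂ d₃ : ℕ) (h0e : d₀ < e) (he1 : e < d₁) (h12 : d₁ < d₂) (h23 : d₂ < d₃)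
    (hC1 : d₀ + d₁ < 2 * e) (hC2 : 2 * e < d₀ + d₂) (hC6 : d₁ + d₂ < e + d₃)
    (dJ m₀ m₁ m₂ m₃ w₀ w₁ w₂ w₃ D01 D02 D03 D12 D13 D23 : ℝ) (hw₀ : 0 < w₀) (hw₃ : 0 < w₃) (hm₃ : m₃ < 0) (hdJ : dJ < 0)
    (hS : (-dJ) * D03
        * (((d₁ : ℝ) - e) * ((d₂ : ℝ) - e) * ((2 : ℝ) * e - d₀ - d₁) * ((d₀ : ℝ) + d₂ - 2 * e) * ((d₁ : ℝ) + d₂ - 2 * e) * ((d₁ : ℝ) + d₃ - 2 * e) * ((d₂ : ℝ) + d₃ - 2 * e))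
        * (((d₀ : ℝ) + d₃ - e - d₁) * ((e : ℝ) + d₂ - d₀ - d₃) * ((d₃ : ℝ) - d₁) * ((d₃ : ℝ) - d₂) * ((d₁ : ℝ) + d₂ - d₀ - d₃) * ((d₁ : ℝ) - d₀) * ((d₂ : ℝ) - d₀))
        ≤ m₀ * m₃
        * (((d₁ : ℝ) - d₀) * ((d₂ : ℝ) - d₀) * ((d₁ : ℝ) - e) * ((d₂ : ℝ) - e) * ((d₁ : ℝ) + d₂ - e - d₀) * ((d₁ : ℝ) + d₃ - e - d₀) * ((d₂ : ℝ) + d₃ - e - d₀))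
        * (((d₃ : ℝ) - d₁) * ((d₃ : ℝ) - d₂) * ((e : ℝ) + d₃ - d₀ - d₁) * ((e : ℝ) + d₃ - d₀ - d₂) * ((e : ℝ) + d₃ - d₁ - d₂) * ((d₁ : ℝ) - e) * ((d₂ : ℝ) - e))) :
    ((∑ i : Fin 11, Polynomial.C ((![dJ, w₀ * m₀, w₁ * m₁, w₂ * m₂, w₃ * m₃, w₀ * w₁ * D01, w₀ * w₂ * D02, w₀ * w₃ * D03, w₁ * w₂ * D12, w₁ * w₃ * D13, w₂ * w₃ * D23] : Fin 11 → ℝ) i) * X ^ ((![2 * e, e + d₀, e + d₁, e + d₂, e + d₃, d₀ + d₁, d₀ + d₂, d₀ + d₃, d₁ + d₂, d₁ + d₃, d₂ + d₃] : Fin 11 → ℕ) i)).roots.toFinset.filter (fun t => 0 < t)).card ≤ 8 := by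
  classical
  have h0e' : (d₀ : ℝ) < e := by exact_mod_cast h0e
  have he1' : (e : ℝ) < d₁ := by exact_mod_cast he1
  have h12' : (d₁ : ℝ) < d₂ := by exact_mod_cast h12
  have h23' : (d₂ : ℝ) < d₃ := by exact_mod_cast h23
  have hC1' : (d₀ : ℝ) + d₁ < 2 * e := by exact_mod_cast hC1
  have hC2' : 2 * (e : ℝ) < d₀ + d₂ := by exact_mod_cast hC2
  have hC6' : (d₁ : ℝ) + d₂ < e + d₃ := by exact_mod_cast hC6
  -- the four distance products (positive atoms)
  obtain ⟨PA, hPA⟩ : ∃ x : ℝ, x = ((d₁ : ℝ) - d₀) * ((d₂ : ℝ) - d₀) * ((d₁ : ℝ) - e) * ((d₂ : ℝ) - e) * ((d₁ : ℝ) + d₂ - e - d₀) * ((d₁ : ℝ) + d₃ - e - d₀) * ((d₂ : ℝ) + d₃ - e - d₀) := ⟨_, rfl⟩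
  obtain ⟨PB, hPB⟩ : ∃ x : ℝ, x = ((d₁ : ℝ) - e) * ((d₂ : ℝ) - e) * ((2 : ℝ) * e - d₀ - d₁) * ((d₀ : ℝ) + d₂ - 2 * e) * ((d₁ : ℝ) + d₂ - 2 * e) * ((d₁ : ℝ) + d₃ - 2 * e) * ((d₂ : ℝ) + d₃ - 2 * e) := ⟨_, rfl⟩
  obtain ⟨PC, hPC⟩ : ∃ x : ℝ, x = ((d₀ : ℝ) + d₃ - e - d₁) * ((e : ℝ) + d₂ - d₀ - d₃) * ((d₃ : ℝ) - d₁) * ((d₃ : ℝ) - d₂) * ((d₁ : ℝ) + d₂ - d₀ - d₃) * ((d₁ : ℝ) - d₀) * ((d₂ : ℝ) - d₀) := ⟨_, rfl⟩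
  obtain ⟨PD, hPD⟩ : ∃ x : ℝ, x = ((d₃ : ℝ) - d₁) * ((d₃ : ℝ) - d₂) * ((e : ℝ) + d₃ - d₀ - d₁) * ((e : ℝ) + d₃ - d₀ - d₂) * ((e : ℝ) + d₃ - d₁ - d₂) * ((d₁ : ℝ) - e) * ((d₂ : ℝ) - e) := ⟨_, rfl⟩
  have hS' : (-dJ) * D03 * PB * PC ≤ m₀ * m₃ * PA * PD := by rw [hPA, hPB, hPC, hPD]; exact hS
  clear hS
  have hPBp : 0 < PB := by
    rw [hPB]
    have f1 : 0 < ((d₁ : ℝ) - e) := by linarith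
    have f2 : 0 < ((d₂ : ℝ) - e) := by linarith
    have f3 : 0 < ((2 : ℝ) * e - d₀ - d₁) := by linarith
    have f4 : 0 < ((d₀ : ℝ) + d₂ - 2 * e) := by linarith
    have f5 : 0 < ((d₁ : ℝ) + d₂ - 2 * e) := by linarith
    have f6 : 0 < ((d₁ : ℝ) + d₃ - 2 * e) := by linarith
    have f7 : 0 < ((d₂ : ℝ) + d₃ - 2 * e) := by linarith
    exact mul_pos (mul_pos (mul_pos (mul_pos (mul_pos (mul_pos f1 f2) f3) f4) f5) f6) f7
  have hPDp : 0 < PD := by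
    rw [hPD]
    have f1 : 0 < ((d₃ : ℝ) - d₁) := by linarith
    have f2 : 0 < ((d₃ : ℝ) - d₂) := by linarith
    have f3 : 0 < ((e : ℝ) + d₃ - d₀ - d₁) := by linarith
    have f4 : 0 < ((e : ℝ) + d₃ - d₀ - d₂) := by linarith
    have f5 : 0 < ((e : ℝ) + d₃ - d₁ - d₂) := by linarith
    have f6 : 0 < ((d₁ : ℝ) - e) := by linarith
    have f7 : 0 < ((d₂ : ℝ) - e) := by linarith
    exact mul_pos (mul_pos (mul_pos (mul_pos (mul_pos (mul_pos f1 f2) f3) f4) f5) f6) f7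
  -- the four surviving coefficients
  obtain ⟨A, hA⟩ : ∃ x : ℝ, x = w₀ * (-m₀) * PA := ⟨_, rfl⟩
  obtain ⟨B, hB⟩ : ∃ x : ℝ, x = (-dJ) * PB := ⟨_, rfl⟩
  obtain ⟨C, hC⟩ : ∃ x : ℝ, x = w₀ * w₃ * D03 * PC := ⟨_, rfl⟩
  obtain ⟨D, hD⟩ : ∃ x : ℝ, x = w₃ * (-m₃) * PD := ⟨_, rfl⟩
  have hBp : 0 < B := by rw [hB]; exact mul_pos (by linarith) hPBp
  have hDp : 0 < D := by rw [hD]; exact mul_pos (mul_pos hw₃ (by linarith)) hPDp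
  have hBC : B * C ≤ A * D := by
    have e1 : B * C = (w₀ * w₃) * ((-dJ) * D03 * PB * PC) := by rw [hB, hC]; ring
    have e2 : A * D = (w₀ * w₃) * (m₀ * m₃ * PA * PD) := by rw [hA, hD]; ring
    rw [e1, e2]
    exact mul_le_mul_of_nonneg_left hS' (mul_pos hw₀ hw₃).le
  -- seven kills
  have hkills := card_posRoots_le_kills (Finset.univ : Finset (Fin 11)) (![2 * e, e + d₀, e + d₁, e + d₂, e + d₃, d₀ + d₁, d₀ + d₂, d₀ + d₃, d₁ + d₂, d₁ + d₃, d₂ + d₃] : Fin 11 → ℕ) [e + d₁, e + d₂, d₀ + d₁, d₀ + d₂, d₁ + d₂, d₁ + d₃, d₂ + d₃] (![dJ, w₀ * m₀, w₁ * m₁, w₂ * m₂, w₃ * m₃, w₀ * w₁ * D01, w₀ * w₂ * D02, w₀ * w₃ * D03, w₁ * w₂ * D12, w₁ * w₃ * D13, w₂ * w₃ * D23] : Fin 11 → ℝ)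
  have hfour : (∑ i ∈ (Finset.univ : Finset (Fin 11)), Polynomial.C ((![dJ, w₀ * m₀, w₁ * m₁, w₂ * m₂, w₃ * m₃, w₀ * w₁ * D01, w₀ * w₂ * D02, w₀ * w₃ * D03, w₁ * w₂ * D12, w₁ * w₃ * D13, w₂ * w₃ * D23] : Fin 11 → ℝ) i
          * (([e + d₁, e + d₂, d₀ + d₁, d₀ + d₂, d₁ + d₂, d₁ + d₃, d₂ + d₃]).map (fun ρ : ℕ => (((((![2 * e, e + d₀, e + d₁, e + d₂, e + d₃, d₀ + d₁, d₀ + d₂, d₀ + d₃, d₁ + d₂, d₁ + d₃, d₂ + d₃] : Fin 11 → ℕ)) i : ℕ) : ℝ) - (ρ : ℝ)))).prod) * X ^ ((![2 * e, e + d₀, e + d₁, e + d₂, e + d₃, d₀ + d₁, d₀ + d₂, d₀ + d₃, d₁ + d₂, d₁ + d₃, d₂ + d₃] : Fin 11 → ℕ) i))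
      = (Polynomial.C A * X ^ (e + d₀) - Polynomial.C B * X ^ (e + d₀ + (e - d₀))
          + Polynomial.C C * X ^ (e + d₀ + (d₃ - e)) - Polynomial.C D * X ^ (e + d₀ + (e - d₀) + (d₃ - e))) := by
    have e3 : e + d₀ + (e - d₀) + (d₃ - e) = e + d₃ := by omega
    have e1 : e + d₀ + (e - d₀) = 2 * e := by omega
    have e2 : e + d₀ + (d₃ - e) = d₀ + d₃ := by omega
    rw [e3, e1, e2]
    have hcoef : ∀ i : Fin 11, (![dJ, w₀ * m₀, w₁ * m₁, w₂ * m₂, w₃ * m₃, w₀ * w₁ * D01, w₀ * w₂ * D02, w₀ * w₃ * D03, w₁ * w₂ * D12, w₁ * w₃ * D13, w₂ * w₃ * D23] : Fin 11 → ℝ) i * (([e + d₁, e + d₂, d₀ + d₁, d₀ + d₂, d₁ + d₂, d₁ + d₃, d₂ + d₃]).map (fun ρ : ℕ => (((((![2 * e, e + d₀, e + d₁, e + d₂, e + d₃, d₀ + d₁, d₀ + d₂, d₀ + d₃, d₁ + d₂, d₁ + d₃, d₂ + d₃] : Fin 11 → ℕ)) i : ℕ) : ℝ) - (ρ : ℝ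)))).prod
        = (![-B, A, 0, 0, -D, 0, 0, C, 0, 0, 0] : Fin 11 → ℝ) i := by
      intro i
      fin_cases i <;>
        simp only [Fin.zero_eta, Fin.mk_one, Fin.isValue, Matrix.cons_val_zero, Matrix.cons_val_one,
          List.map_cons, List.map_nil, List.prod_cons, List.prod_nil, hA, hB, hC, hD, hPA, hPB, hPC, hPD] <;>
        push_cast <;> ring
    rw [Finset.sum_congr rfl (fun i _ => by rw [hcoef i])]
    simp only [Fin.sum_univ_succ, Fin.sum_univ_zero, Matrix.cons_val_zero, Matrix.cons_val_succ, map_zero, zero_mul,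
      zero_add, add_zero, Polynomial.C_neg]
    ring
  rw [hfour] at hkills
  have hone := card_posRoots_fourNomial_le_one A B C D hBp hDp hBC (e + d₀) (e - d₀) (d₃ - e) (by omega)
  simp only [List.length_cons, List.length_nil] at hkills
  omega

/-- **RANK-ONE `(2,4)₁`, ONE BELOW / THREE ABOVE: `Z₊ ≤ 8` under (T₀₃)** (matrix form; `det J < 0`, letter `3` pairing negatively with
`J`, `w₀, w₃ > 0`; (T₀₃) says letters `0` and `3` are close in angle relative to the exponent constant). [this file] -/
theorem oneThree_rankOne_posRoots_le_eight_of_T03 (e d₀ d₁ d₂ d₃ : ℕ) (h0e : d₀ < e) (he1 : e < d₁) (h12 : d₁ < d₂) (h23 : d₂ < d₃)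
    (hC1 : d₀ + d₁ < 2 * e) (hC2 : 2 * e < d₀ + d₂) (hC6 : d₁ + d₂ < e + d₃)
    (J : Matrix (Fin 2) (Fin 2) ℝ) (v₀ v₁ v₂ v₃ : Fin 2 → ℝ) (w₀ w₁ w₂ w₃ : ℝ) (hw₀ : 0 < w₀) (hw₃ : 0 < w₃) (hm₃ : (J 0 0 * v₃ 1 ^ 2 + J 1 1 * v₃ 0 ^ 2 - (J 0 1 + J 1 0) * (v₃ 0 * v₃ 1)) < 0) (hJ : J.det < 0)
    (hS : (-J.det) * ((v₀ 0 * v₃ 1 - v₀ 1 * v₃ 0) ^ 2)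
        * (((d₁ : ℝ) - e) * ((d₂ : ℝ) - e) * ((2 : ℝ) * e - d₀ - d₁) * ((d₀ : ℝ) + d₂ - 2 * e) * ((d₁ : ℝ) + d₂ - 2 * e) * ((d₁ : ℝ) + d₃ - 2 * e) * ((d₂ : ℝ) + d₃ - 2 * e))
        * (((d₀ : ℝ) + d₃ - e - d₁) * ((e : ℝ) + d₂ - d₀ - d₃) * ((d₃ : ℝ) - d₁) * ((d₃ : ℝ) - d₂) * ((d₁ : ℝ) + d₂ - d₀ - d₃) * ((d₁ : ℝ) - d₀) * ((d₂ : ℝ) - d₀))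
        ≤ (J 0 0 * v₀ 1 ^ 2 + J 1 1 * v₀ 0 ^ 2 - (J 0 1 + J 1 0) * (v₀ 0 * v₀ 1)) * (J 0 0 * v₃ 1 ^ 2 + J 1 1 * v₃ 0 ^ 2 - (J 0 1 + J 1 0) * (v₃ 0 * v₃ 1))
        * (((d₁ : ℝ) - d₀) * ((d₂ : ℝ) - d₀) * ((d₁ : ℝ) - e) * ((d₂ : ℝ) - e) * ((d₁ : ℝ) + d₂ - e - d₀) * ((d₁ : ℝ) + d₃ - e - d₀) * ((d₂ : ℝ) + d₃ - e - d₀))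
        * (((d₃ : ℝ) - d₁) * ((d₃ : ℝ) - d₂) * ((e : ℝ) + d₃ - d₀ - d₁) * ((e : ℝ) + d₃ - d₀ - d₂) * ((e : ℝ) + d₃ - d₁ - d₂) * ((d₁ : ℝ) - e) * ((d₂ : ℝ) - e))) :
    ((Matrix.det (((X : ℝ[X]) ^ e) • J.map Polynomial.C
        + (Polynomial.C w₀ * X ^ d₀) • (vecMulVec v₀ v₀).map Polynomial.C
        + (Polynomial.C w₁ * X ^ d₁) • (vecMulVec v₁ v₁).map Polynomial.C
        + (Polynomial.C w₂ * X ^ d₂) • (vecMulVec v₂ v₂).map Polynomial.C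
        + (Polynomial.C w₃ * X ^ d₃) • (vecMulVec v₃ v₃).map Polynomial.C)).roots.toFinset.filter (fun t => 0 < t)).card
      ≤ 8 := by
  rw [det_rankOne_four_sum]
  exact elevenNomial_oneThree_T03_le_eight e d₀ d₁ d₂ d₃ h0e he1 h12 h23 hC1 hC2 hC6 J.det _ _ _ _ w₀ w₁ w₂ w₃ _ _ _ _ _ _
    hw₀ hw₃ hm₃ hJ hS

/-! ## 2. Condition (T₀₁): letters `0` (below) and `1` close -/

/-- **(T₀₁), real-parameter form.**  The eleven-nomial of the split `d₀ < e < d₁ < d₂ < d₃` with `d₀+d₂ < e+d₁ < d₀+d₃` (`m₁ < 0`,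
`D01 > 0`, `w₀, w₁ > 0`, `dJ` and everything else arbitrary) has at most EIGHT positive roots under condition (T₀₁) (kept degrees
`e+d₀, d₀+d₁, 2e, e+d₁`). -/
theorem elevenNomial_oneThree_T01_le_eight (e d₀ d₁ d₂ d₃ : ℕ) (h0e : d₀ < e) (he1 : e < d₁) (h12 : d₁ < d₂) (h23 : d₂ < d₃)
    (hC3 : d₀ + d₂ < e + d₁) (hC4 : e + d₁ < d₀ + d₃)
    (dJ m₀ m₁ m₂ m₃ w₀ w₁ w₂ w₃ D01 D02 D03 D12 D13 D23 : ℝ) (hw₀ : 0 < w₀) (hw₁ : 0 < w₁) (hm₁ : m₁ < 0) (hD01 : 0 < D01)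
    (hS : (-dJ) * D01
        * (((e : ℝ) + d₂ - d₀ - d₁) * ((e : ℝ) + d₃ - d₀ - d₁) * ((d₂ : ℝ) - d₁) * ((d₃ : ℝ) - d₁) * ((d₂ : ℝ) - d₀) * ((d₃ : ℝ) - d₀) * ((d₂ : ℝ) + d₃ - d₀ - d₁))
        * (((d₂ : ℝ) - e) * ((d₃ : ℝ) - e) * ((d₀ : ℝ) + d₂ - 2 * e) * ((d₀ : ℝ) + d₃ - 2 * e) * ((d₁ : ℝ) + d₂ - 2 * e) * ((d₁ : ℝ) + d₃ - 2 * e) * ((d₂ : ℝ) + d₃ - 2 * e))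
        ≤ m₀ * m₁
        * (((d₂ : ℝ) - d₀) * ((d₃ : ℝ) - d₀) * ((d₂ : ℝ) - e) * ((d₃ : ℝ) - e) * ((d₁ : ℝ) + d₂ - e - d₀) * ((d₁ : ℝ) + d₃ - e - d₀) * ((d₂ : ℝ) + d₃ - e - d₀))
        * (((d₂ : ℝ) - d₁) * ((d₃ : ℝ) - d₁) * ((e : ℝ) + d₁ - d₀ - d₂) * ((d₀ : ℝ) + d₃ - e - d₁) * ((d₂ : ℝ) - e) * ((d₃ : ℝ) - e) * ((d₂ : ℝ) + d₃ - e - d₁))) :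
    ((∑ i : Fin 11, Polynomial.C ((![dJ, w₀ * m₀, w₁ * m₁, w₂ * m₂, w₃ * m₃, w₀ * w₁ * D01, w₀ * w₂ * D02, w₀ * w₃ * D03, w₁ * w₂ * D12, w₁ * w₃ * D13, w₂ * w₃ * D23] : Fin 11 → ℝ) i) * X ^ ((![2 * e, e + d₀, e + d₁, e + d₂, e + d₃, d₀ + d₁, d₀ + d₂, d₀ + d₃, d₁ + d₂, d₁ + d₃, d₂ + d₃] : Fin 11 → ℕ) i)).roots.toFinset.filter (fun t => 0 < t)).card ≤ 8 := by
  classical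
  have h0e' : (d₀ : ℝ) < e := by exact_mod_cast h0e
  have he1' : (e : ℝ) < d₁ := by exact_mod_cast he1
  have h12' : (d₁ : ℝ) < d₂ := by exact_mod_cast h12
  have h23' : (d₂ : ℝ) < d₃ := by exact_mod_cast h23
  have hC3' : (d₀ : ℝ) + d₂ < e + d₁ := by exact_mod_cast hC3
  have hC4' : (e : ℝ) + d₁ < d₀ + d₃ := by exact_mod_cast hC4
  -- the four distance products (positive atoms)
  obtain ⟨PA, hPA⟩ : ∃ x : ℝ, x = ((d₂ : ℝ) - d₀) * ((d₃ : ℝ) - d₀) * ((d₂ : ℝ) - e) * ((d₃ : ℝ) - e) * ((d₁ : ℝ) + d₂ - e - d₀) * ((d₁ : ℝ) + d₃ - e - d₀) * ((d₂ : ℝ) + d₃ - e - d₀) := ⟨_, rfl⟩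
  obtain ⟨PB, hPB⟩ : ∃ x : ℝ, x = ((e : ℝ) + d₂ - d₀ - d₁) * ((e : ℝ) + d₃ - d₀ - d₁) * ((d₂ : ℝ) - d₁) * ((d₃ : ℝ) - d₁) * ((d₂ : ℝ) - d₀) * ((d₃ : ℝ) - d₀) * ((d₂ : ℝ) + d₃ - d₀ - d₁) := ⟨_, rfl⟩
  obtain ⟨PC, hPC⟩ : ∃ x : ℝ, x = ((d₂ : ℝ) - e) * ((d₃ : ℝ) - e) * ((d₀ : ℝ) + d₂ - 2 * e) * ((d₀ : ℝ) + d₃ - 2 * e) * ((d₁ : ℝ) + d₂ - 2 * e) * ((d₁ : ℝ) + d₃ - 2 * e) * ((d₂ : ℝ) + d₃ - 2 * e) := ⟨_, rfl⟩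
  obtain ⟨PD, hPD⟩ : ∃ x : ℝ, x = ((d₂ : ℝ) - d₁) * ((d₃ : ℝ) - d₁) * ((e : ℝ) + d₁ - d₀ - d₂) * ((d₀ : ℝ) + d₃ - e - d₁) * ((d₂ : ℝ) - e) * ((d₃ : ℝ) - e) * ((d₂ : ℝ) + d₃ - e - d₁) := ⟨_, rfl⟩
  have hS' : (-dJ) * D01 * PB * PC ≤ m₀ * m₁ * PA * PD := by rw [hPA, hPB, hPC, hPD]; exact hS
  clear hS
  have hPBp : 0 < PB := by
    rw [hPB]
    have f1 : 0 < ((e : ℝ) + d₂ - d₀ - d₁) := by linarith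
    have f2 : 0 < ((e : ℝ) + d₃ - d₀ - d₁) := by linarith
    have f3 : 0 < ((d₂ : ℝ) - d₁) := by linarith
    have f4 : 0 < ((d₃ : ℝ) - d₁) := by linarith
    have f5 : 0 < ((d₂ : ℝ) - d₀) := by linarith
    have f6 : 0 < ((d₃ : ℝ) - d₀) := by linarith
    have f7 : 0 < ((d₂ : ℝ) + d₃ - d₀ - d₁) := by linarith
    exact mul_pos (mul_pos (mul_pos (mul_pos (mul_pos (mul_pos f1 f2) f3) f4) f5) f6) f7
  have hPDp : 0 < PD := by
    rw [hPD]
    have f1 : 0 < ((d₂ : ℝ) - d₁) := by linarith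
    have f2 : 0 < ((d₃ : ℝ) - d₁) := by linarith
    have f3 : 0 < ((e : ℝ) + d₁ - d₀ - d₂) := by linarith
    have f4 : 0 < ((d₀ : ℝ) + d₃ - e - d₁) := by linarith
    have f5 : 0 < ((d₂ : ℝ) - e) := by linarith
    have f6 : 0 < ((d₃ : ℝ) - e) := by linarith
    have f7 : 0 < ((d₂ : ℝ) + d₃ - e - d₁) := by linarith
    exact mul_pos (mul_pos (mul_pos (mul_pos (mul_pos (mul_pos f1 f2) f3) f4) f5) f6) f7
  -- the four surviving coefficients
  obtain ⟨A, hA⟩ : ∃ x : ℝ, x = w₀ * (-m₀) * PA := ⟨_, rfl⟩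
  obtain ⟨B, hB⟩ : ∃ x : ℝ, x = w₀ * w₁ * D01 * PB := ⟨_, rfl⟩
  obtain ⟨C, hC⟩ : ∃ x : ℝ, x = (-dJ) * PC := ⟨_, rfl⟩
  obtain ⟨D, hD⟩ : ∃ x : ℝ, x = w₁ * (-m₁) * PD := ⟨_, rfl⟩
  have hBp : 0 < B := by rw [hB]; exact mul_pos (mul_pos (mul_pos hw₀ hw₁) hD01) hPBp
  have hDp : 0 < D := by rw [hD]; exact mul_pos (mul_pos hw₁ (by linarith)) hPDp
  have hBC : B * C ≤ A * D := by
    have e1 : B * C = (w₀ * w₁) * ((-dJ) * D01 * PB * PC) := by rw [hB, hC]; ring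
    have e2 : A * D = (w₀ * w₁) * (m₀ * m₁ * PA * PD) := by rw [hA, hD]; ring
    rw [e1, e2]
    exact mul_le_mul_of_nonneg_left hS' (mul_pos hw₀ hw₁).le
  -- seven kills
  have hkills := card_posRoots_le_kills (Finset.univ : Finset (Fin 11)) (![2 * e, e + d₀, e + d₁, e + d₂, e + d₃, d₀ + d₁, d₀ + d₂, d₀ + d₃, d₁ + d₂, d₁ + d₃, d₂ + d₃] : Fin 11 → ℕ) [e + d₂, e + d₃, d₀ + d₂, d₀ + d₃, d₁ + d₂, d₁ + d₃, d₂ + d₃] (![dJ, w₀ * m₀, w₁ * m₁, w₂ * m₂, w₃ * m₃, w₀ * w₁ * D01, w₀ * w₂ * D02, w₀ * w₃ * D03, w₁ * w₂ * D12, w₁ * w₃ * D13, w₂ * w₃ * D23] : Fin 11 → ℝ)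
  have hfour : (∑ i ∈ (Finset.univ : Finset (Fin 11)), Polynomial.C ((![dJ, w₀ * m₀, w₁ * m₁, w₂ * m₂, w₃ * m₃, w₀ * w₁ * D01, w₀ * w₂ * D02, w₀ * w₃ * D03, w₁ * w₂ * D12, w₁ * w₃ * D13, w₂ * w₃ * D23] : Fin 11 → ℝ) i
          * (([e + d₂, e + d₃, d₀ + d₂, d₀ + d₃, d₁ + d₂, d₁ + d₃, d₂ + d₃]).map (fun ρ : ℕ => (((((![2 * e, e + d₀, e + d₁, e + d₂, e + d₃, d₀ + d₁, d₀ + d₂, d₀ + d₃, d₁ + d₂, d₁ + d₃, d₂ + d₃] : Fin 11 → ℕ)) i : ℕ) : ℝ) - (ρ : ℝ)))).prod) * X ^ ((![2 * e, e + d₀, e + d₁, e + d₂, e + d₃, d₀ + d₁, d₀ + d₂, d₀ + d₃, d₁ + d₂, d₁ + d₃, d₂ + d₃] : Fin 11 → ℕ) i))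
      = (Polynomial.C A * X ^ (e + d₀) - Polynomial.C B * X ^ (e + d₀ + (d₁ - e))
          + Polynomial.C C * X ^ (e + d₀ + (e - d₀)) - Polynomial.C D * X ^ (e + d₀ + (d₁ - e) + (e - d₀))) := by
    have e3 : e + d₀ + (d₁ - e) + (e - d₀) = e + d₁ := by omega
    have e1 : e + d₀ + (d₁ - e) = d₀ + d₁ := by omega
    have e2 : e + d₀ + (e - d₀) = 2 * e := by omega
    rw [e3, e1, e2]
    have hcoef : ∀ i : Fin 11, (![dJ, w₀ * m₀, w₁ * m₁, w₂ * m₂, w₃ * m₃, w₀ * w₁ * D01, w₀ * w₂ * D02, w₀ * w₃ * D03, w₁ * w₂ * D12, w₁ * w₃ * D13, w₂ * w₃ * D23] : Fin 11 → ℝ) i * (([e + d₂, e + d₃, d₀ + d₂, d₀ + d₃, d₁ + d₂, d₁ + d₃, d₂ + d₃]).map (fun ρ : ℕ => (((((![2 * e, e + d₀, e + d₁, e + d₂, e + d₃, d₀ + d₁, d₀ + d₂, d₀ + d₃, d₁ + d₂, d₁ + d₃, d₂ + d₃] : Fin 11 → ℕ)) i : ℕ) : ℝ) - (ρ : ℝ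)))).prod
        = (![C, A, -D, 0, 0, -B, 0, 0, 0, 0, 0] : Fin 11 → ℝ) i := by
      intro i
      fin_cases i <;>
        simp only [Fin.zero_eta, Fin.mk_one, Fin.isValue, Matrix.cons_val_zero, Matrix.cons_val_one,
          List.map_cons, List.map_nil, List.prod_cons, List.prod_nil, hA, hB, hC, hD, hPA, hPB, hPC, hPD] <;>
        push_cast <;> ring
    rw [Finset.sum_congr rfl (fun i _ => by rw [hcoef i])]
    simp only [Fin.sum_univ_succ, Fin.sum_univ_zero, Matrix.cons_val_zero, Matrix.cons_val_succ, map_zero, zero_mul,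
      zero_add, add_zero, Polynomial.C_neg]
    ring
  rw [hfour] at hkills
  have hone := card_posRoots_fourNomial_le_one A B C D hBp hDp hBC (e + d₀) (d₁ - e) (e - d₀) (by omega)
  simp only [List.length_cons, List.length_nil] at hkills
  omega

/-- **RANK-ONE `(2,4)₁`, ONE BELOW / THREE ABOVE: `Z₊ ≤ 8` under (T₀₁)** (matrix form; `J` arbitrary, letter `1` pairing negatively with `J`,
letters `0, 1` not parallel, `w₀, w₁ > 0`; (T₀₁) says letters `0` and `1` are close in angle). [this file] -/
theorem oneThree_rankOne_posRoots_le_eight_of_T01 (e d₀ d₁ d₂ d₃ : ℕ) (h0e : d₀ < e) (he1 : e < d₁) (h12 : d₁ < d₂) (h23 : d₂ < d₃)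
    (hC3 : d₀ + d₂ < e + d₁) (hC4 : e + d₁ < d₀ + d₃)
    (J : Matrix (Fin 2) (Fin 2) ℝ) (v₀ v₁ v₂ v₃ : Fin 2 → ℝ) (w₀ w₁ w₂ w₃ : ℝ) (hw₀ : 0 < w₀) (hw₁ : 0 < w₁) (hm₁ : (J 0 0 * v₁ 1 ^ 2 + J 1 1 * v₁ 0 ^ 2 - (J 0 1 + J 1 0) * (v₁ 0 * v₁ 1)) < 0) (hv01 : v₀ 0 * v₁ 1 - v₀ 1 * v₁ 0 ≠ 0)
    (hS : (-J.det) * ((v₀ 0 * v₁ 1 - v₀ 1 * v₁ 0) ^ 2)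
        * (((e : ℝ) + d₂ - d₀ - d₁) * ((e : ℝ) + d₃ - d₀ - d₁) * ((d₂ : ℝ) - d₁) * ((d₃ : ℝ) - d₁) * ((d₂ : ℝ) - d₀) * ((d₃ : ℝ) - d₀) * ((d₂ : ℝ) + d₃ - d₀ - d₁))
        * (((d₂ : ℝ) - e) * ((d₃ : ℝ) - e) * ((d₀ : ℝ) + d₂ - 2 * e) * ((d₀ : ℝ) + d₃ - 2 * e) * ((d₁ : ℝ) + d₂ - 2 * e) * ((d₁ : ℝ) + d₃ - 2 * e) * ((d₂ : ℝ) + d₃ - 2 * e))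
        ≤ (J 0 0 * v₀ 1 ^ 2 + J 1 1 * v₀ 0 ^ 2 - (J 0 1 + J 1 0) * (v₀ 0 * v₀ 1)) * (J 0 0 * v₁ 1 ^ 2 + J 1 1 * v₁ 0 ^ 2 - (J 0 1 + J 1 0) * (v₁ 0 * v₁ 1))
        * (((d₂ : ℝ) - d₀) * ((d₃ : ℝ) - d₀) * ((d₂ : ℝ) - e) * ((d₃ : ℝ) - e) * ((d₁ : ℝ) + d₂ - e - d₀) * ((d₁ : ℝ) + d₃ - e - d₀) * ((d₂ : ℝ) + d₃ - e - d₀))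
        * (((d₂ : ℝ) - d₁) * ((d₃ : ℝ) - d₁) * ((e : ℝ) + d₁ - d₀ - d₂) * ((d₀ : ℝ) + d₃ - e - d₁) * ((d₂ : ℝ) - e) * ((d₃ : ℝ) - e) * ((d₂ : ℝ) + d₃ - e - d₁))) :
    ((Matrix.det (((X : ℝ[X]) ^ e) • J.map Polynomial.C
        + (Polynomial.C w₀ * X ^ d₀) • (vecMulVec v₀ v₀).map Polynomial.C
        + (Polynomial.C w₁ * X ^ d₁) • (vecMulVec v₁ v₁).map Polynomial.C
        + (Polynomial.C w₂ * X ^ d₂) • (vecMulVec v₂ v₂).map Polynomial.C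
        + (Polynomial.C w₃ * X ^ d₃) • (vecMulVec v₃ v₃).map Polynomial.C)).roots.toFinset.filter (fun t => 0 < t)).card
      ≤ 8 := by
  rw [det_rankOne_four_sum]
  exact elevenNomial_oneThree_T01_le_eight e d₀ d₁ d₂ d₃ h0e he1 h12 h23 hC3 hC4 J.det _ _ _ _ w₀ w₁ w₂ w₃ _ _ _ _ _ _
    hw₀ hw₁ hm₁ (by positivity) hS

/-! ## 3. Condition (T₁₂): the above-pivot letters `1` and `2` far apart -/

/-- **(T₁₂), real-parameter form.**  The eleven-nomial of the split `d₀ < e < d₁ < d₂ < d₃` with `d₀+d₂ < e+d₁ < d₀+d₃ < e+d₂`,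
`d₁+d₂ < e+d₃` (`m₁ < 0`, `D12 > 0`, `w₁, w₂ > 0`, `dJ` and everything else arbitrary) has at most EIGHT positive roots under condition
(T₁₂) (kept degrees `2e, e+d₁, e+d₂, d₁+d₂`). -/
theorem elevenNomial_oneThree_T12_le_eight (e d₀ d₁ d₂ d₃ : ℕ) (h0e : d₀ < e) (he1 : e < d₁) (h12 : d₁ < d₂) (h23 : d₂ < d₃)
    (hC3 : d₀ + d₂ < e + d₁) (hC4 : e + d₁ < d₀ + d₃) (hC5 : d₀ + d₃ < e + d₂) (hC6 : d₁ + d₂ < e + d₃)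
    (dJ m₀ m₁ m₂ m₃ w₀ w₁ w₂ w₃ D01 D02 D03 D12 D13 D23 : ℝ) (hw₁ : 0 < w₁) (hw₂ : 0 < w₂) (hm₁ : m₁ < 0) (hD12 : 0 < D12)
    (hS : m₁ * m₂
        * (((d₁ : ℝ) - d₀) * ((d₃ : ℝ) - d₁) * ((e : ℝ) - d₀) * ((e : ℝ) + d₁ - d₀ - d₂) * ((d₀ : ℝ) + d₃ - e - d₁) * ((d₃ : ℝ) - e) * ((d₂ : ℝ) + d₃ - e - d₁))
        * (((d₂ : ℝ) - d₀) * ((d₃ : ℝ) - d₂) * ((e : ℝ) + d₂ - d₀ - d₁) * ((e : ℝ) - d₀) * ((e : ℝ) + d₂ - d₀ - d₃) * ((d₁ : ℝ) + d₃ - e - d₂) * ((d₃ : ℝ) - e))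
        ≤ (-dJ) * D12
        * (((e : ℝ) - d₀) * ((d₃ : ℝ) - e) * ((2 : ℝ) * e - d₀ - d₁) * ((d₀ : ℝ) + d₂ - 2 * e) * ((d₀ : ℝ) + d₃ - 2 * e) * ((d₁ : ℝ) + d₃ - 2 * e) * ((d₂ : ℝ) + d₃ - 2 * e))
        * (((d₁ : ℝ) + d₂ - e - d₀) * ((e : ℝ) + d₃ - d₁ - d₂) * ((d₂ : ℝ) - d₀) * ((d₁ : ℝ) - d₀) * ((d₁ : ℝ) + d₂ - d₀ - d₃) * ((d₃ : ℝ) - d₂) * ((d₃ : ℝ) - d₁))) :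
    ((∑ i : Fin 11, Polynomial.C ((![dJ, w₀ * m₀, w₁ * m₁, w₂ * m₂, w₃ * m₃, w₀ * w₁ * D01, w₀ * w₂ * D02, w₀ * w₃ * D03, w₁ * w₂ * D12, w₁ * w₃ * D13, w₂ * w₃ * D23] : Fin 11 → ℝ) i) * X ^ ((![2 * e, e + d₀, e + d₁, e + d₂, e + d₃, d₀ + d₁, d₀ + d₂, d₀ + d₃, d₁ + d₂, d₁ + d₃, d₂ + d₃] : Fin 11 → ℕ) i)).roots.toFinset.filter (fun t => 0 < t)).card ≤ 8 := by
  classical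
  have h0e' : (d₀ : ℝ) < e := by exact_mod_cast h0e
  have he1' : (e : ℝ) < d₁ := by exact_mod_cast he1
  have h12' : (d₁ : ℝ) < d₂ := by exact_mod_cast h12
  have h23' : (d₂ : ℝ) < d₃ := by exact_mod_cast h23
  have hC3' : (d₀ : ℝ) + d₂ < e + d₁ := by exact_mod_cast hC3
  have hC4' : (e : ℝ) + d₁ < d₀ + d₃ := by exact_mod_cast hC4
  have hC5' : (d₀ : ℝ) + d₃ < e + d₂ := by exact_mod_cast hC5
  have hC6' : (d₁ : ℝ) + d₂ < e + d₃ := by exact_mod_cast hC6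
  -- the four distance products (positive atoms)
  obtain ⟨PA, hPA⟩ : ∃ x : ℝ, x = ((e : ℝ) - d₀) * ((d₃ : ℝ) - e) * ((2 : ℝ) * e - d₀ - d₁) * ((d₀ : ℝ) + d₂ - 2 * e) * ((d₀ : ℝ) + d₃ - 2 * e) * ((d₁ : ℝ) + d₃ - 2 * e) * ((d₂ : ℝ) + d₃ - 2 * e) := ⟨_, rfl⟩
  obtain ⟨PB, hPB⟩ : ∃ x : ℝ, x = ((d₁ : ℝ) - d₀) * ((d₃ : ℝ) - d₁) * ((e : ℝ) - d₀) * ((e : ℝ) + d₁ - d₀ - d₂) * ((d₀ : ℝ) + d₃ - e - d₁) * ((d₃ : ℝ) - e) * ((d₂ : ℝ) + d₃ - e - d₁) := ⟨_, rfl⟩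
  obtain ⟨PC, hPC⟩ : ∃ x : ℝ, x = ((d₂ : ℝ) - d₀) * ((d₃ : ℝ) - d₂) * ((e : ℝ) + d₂ - d₀ - d₁) * ((e : ℝ) - d₀) * ((e : ℝ) + d₂ - d₀ - d₃) * ((d₁ : ℝ) + d₃ - e - d₂) * ((d₃ : ℝ) - e) := ⟨_, rfl⟩
  obtain ⟨PD, hPD⟩ : ∃ x : ℝ, x = ((d₁ : ℝ) + d₂ - e - d₀) * ((e : ℝ) + d₃ - d₁ - d₂) * ((d₂ : ℝ) - d₀) * ((d₁ : ℝ) - d₀) * ((d₁ : ℝ) + d₂ - d₀ - d₃) * ((d₃ : ℝ) - d₂) * ((d₃ : ℝ) - d₁) := ⟨_, rfl⟩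
  have hS' : m₁ * m₂ * PB * PC ≤ (-dJ) * D12 * PA * PD := by rw [hPA, hPB, hPC, hPD]; exact hS
  clear hS
  have hPBp : 0 < PB := by
    rw [hPB]
    have f1 : 0 < ((d₁ : ℝ) - d₀) := by linarith
    have f2 : 0 < ((d₃ : ℝ) - d₁) := by linarith
    have f3 : 0 < ((e : ℝ) - d₀) := by linarith
    have f4 : 0 < ((e : ℝ) + d₁ - d₀ - d₂) := by linarith
    have f5 : 0 < ((d₀ : ℝ) + d₃ - e - d₁) := by linarith
    have f6 : 0 < ((d₃ : ℝ) - e) := by linarith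
    have f7 : 0 < ((d₂ : ℝ) + d₃ - e - d₁) := by linarith
    exact mul_pos (mul_pos (mul_pos (mul_pos (mul_pos (mul_pos f1 f2) f3) f4) f5) f6) f7
  have hPDp : 0 < PD := by
    rw [hPD]
    have f1 : 0 < ((d₁ : ℝ) + d₂ - e - d₀) := by linarith
    have f2 : 0 < ((e : ℝ) + d₃ - d₁ - d₂) := by linarith
    have f3 : 0 < ((d₂ : ℝ) - d₀) := by linarith
    have f4 : 0 < ((d₁ : ℝ) - d₀) := by linarith
    have f5 : 0 < ((d₁ : ℝ) + d₂ - d₀ - d₃) := by linarith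
    have f6 : 0 < ((d₃ : ℝ) - d₂) := by linarith
    have f7 : 0 < ((d₃ : ℝ) - d₁) := by linarith
    exact mul_pos (mul_pos (mul_pos (mul_pos (mul_pos (mul_pos f1 f2) f3) f4) f5) f6) f7
  -- the four surviving coefficients
  obtain ⟨A, hA⟩ : ∃ x : ℝ, x = (-dJ) * PA := ⟨_, rfl⟩
  obtain ⟨B, hB⟩ : ∃ x : ℝ, x = w₁ * (-m₁) * PB := ⟨_, rfl⟩
  obtain ⟨C, hC⟩ : ∃ x : ℝ, x = w₂ * (-m₂) * PC := ⟨_, rfl⟩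
  obtain ⟨D, hD⟩ : ∃ x : ℝ, x = w₁ * w₂ * D12 * PD := ⟨_, rfl⟩
  have hBp : 0 < B := by rw [hB]; exact mul_pos (mul_pos hw₁ (by linarith)) hPBp
  have hDp : 0 < D := by rw [hD]; exact mul_pos (mul_pos (mul_pos hw₁ hw₂) hD12) hPDp
  have hBC : B * C ≤ A * D := by
    have e1 : B * C = (w₁ * w₂) * (m₁ * m₂ * PB * PC) := by rw [hB, hC]; ring
    have e2 : A * D = (w₁ * w₂) * ((-dJ) * D12 * PA * PD) := by rw [hA, hD]; ring
    rw [e1, e2]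
    exact mul_le_mul_of_nonneg_left hS' (mul_pos hw₁ hw₂).le
  -- seven kills
  have hkills := card_posRoots_le_kills (Finset.univ : Finset (Fin 11)) (![2 * e, e + d₀, e + d₁, e + d₂, e + d₃, d₀ + d₁, d₀ + d₂, d₀ + d₃, d₁ + d₂, d₁ + d₃, d₂ + d₃] : Fin 11 → ℕ) [e + d₀, e + d₃, d₀ + d₁, d₀ + d₂, d₀ + d₃, d₁ + d₃, d₂ + d₃] (![dJ, w₀ * m₀, w₁ * m₁, w₂ * m₂, w₃ * m₃, w₀ * w₁ * D01, w₀ * w₂ * D02, w₀ * w₃ * D03, w₁ * w₂ * D12, w₁ * w₃ * D13, w₂ * w₃ * D23] : Fin 11 → ℝ)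
  have hfour : (∑ i ∈ (Finset.univ : Finset (Fin 11)), Polynomial.C ((![dJ, w₀ * m₀, w₁ * m₁, w₂ * m₂, w₃ * m₃, w₀ * w₁ * D01, w₀ * w₂ * D02, w₀ * w₃ * D03, w₁ * w₂ * D12, w₁ * w₃ * D13, w₂ * w₃ * D23] : Fin 11 → ℝ) i
          * (([e + d₀, e + d₃, d₀ + d₁, d₀ + d₂, d₀ + d₃, d₁ + d₃, d₂ + d₃]).map (fun ρ : ℕ => (((((![2 * e, e + d₀, e + d₁, e + d₂, e + d₃, d₀ + d₁, d₀ + d₂, d₀ + d₃, d₁ + d₂, d₁ + d₃, d₂ + d₃] : Fin 11 → ℕ)) i : ℕ) : ℝ) - (ρ : ℝ)))).prod) * X ^ ((![2 * e, e + d₀, e + d₁, e + d₂, e + d₃, d₀ + d₁, d₀ + d₂, d₀ + d₃, d₁ + d₂, d₁ + d₃, d₂ + d₃] : Fin 11 → ℕ) i))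
      = (Polynomial.C A * X ^ (2 * e) - Polynomial.C B * X ^ (2 * e + (d₁ - e))
          + Polynomial.C C * X ^ (2 * e + (d₂ - e)) - Polynomial.C D * X ^ (2 * e + (d₁ - e) + (d₂ - e))) := by
    have e3 : 2 * e + (d₁ - e) + (d₂ - e) = d₁ + d₂ := by omega
    have e1 : 2 * e + (d₁ - e) = e + d₁ := by omega
    have e2 : 2 * e + (d₂ - e) = e + d₂ := by omega
    rw [e3, e1, e2]
    have hcoef : ∀ i : Fin 11, (![dJ, w₀ * m₀, w₁ * m₁, w₂ * m₂, w₃ * m₃, w₀ * w₁ * D01, w₀ * w₂ * D02, w₀ * w₃ * D03, w₁ * w₂ * D12, w₁ * w₃ * D13, w₂ * w₃ * D23] : Fin 11 → ℝ) i * (([e + d₀, e + d₃, d₀ + d₁, d₀ + d₂, d₀ + d₃, d₁ + d₃, d₂ + d₃]).map (fun ρ : ℕ => (((((![2 * e, e + d₀, e + d₁, e + d₂, e + d₃, d₀ + d₁, d₀ + d₂, d₀ + d₃, d₁ + d₂, d₁ + d₃, d₂ + d₃] : Fin 11 → ℕ)) i : ℕ) : ℝ) - (ρ : ℝ)))).p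rod
        = (![A, 0, -B, C, 0, 0, 0, 0, -D, 0, 0] : Fin 11 → ℝ) i := by
      intro i
      fin_cases i <;>
        simp only [Fin.zero_eta, Fin.mk_one, Fin.isValue, Matrix.cons_val_zero, Matrix.cons_val_one,
          List.map_cons, List.map_nil, List.prod_cons, List.prod_nil, hA, hB, hC, hD, hPA, hPB, hPC, hPD] <;>
        push_cast <;> ring
    rw [Finset.sum_congr rfl (fun i _ => by rw [hcoef i])]
    simp only [Fin.sum_univ_succ, Fin.sum_univ_zero, Matrix.cons_val_zero, Matrix.cons_val_succ, map_zero, zero_mul,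
      zero_add, add_zero, Polynomial.C_neg]
    ring
  rw [hfour] at hkills
  have hone := card_posRoots_fourNomial_le_one A B C D hBp hDp hBC (2 * e) (d₁ - e) (d₂ - e) (by omega)
  simp only [List.length_cons, List.length_nil] at hkills
  omega

/-- **RANK-ONE `(2,4)₁`, ONE BELOW / THREE ABOVE: `Z₊ ≤ 8` under (T₁₂)** (matrix form; `J` arbitrary, letter `1` pairing negatively with `J`,
letters `1, 2` not parallel, `w₁, w₂ > 0`; (T₁₂) says the same-side letters `1` and `2` are far apart in angle). [this file] -/
theorem oneThree_rankOne_posRoots_le_eight_of_T12 (e d₀ d₁ d₂ d₃ : ℕ) (h0e : d₀ < e) (he1 : e < d₁) (h12 : d₁ < d₂) (h23 : d₂ < d₃)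
    (hC3 : d₀ + d₂ < e + d₁) (hC4 : e + d₁ < d₀ + d₃) (hC5 : d₀ + d₃ < e + d₂) (hC6 : d₁ + d₂ < e + d₃)
    (J : Matrix (Fin 2) (Fin 2) ℝ) (v₀ v₁ v₂ v₃ : Fin 2 → ℝ) (w₀ w₁ w₂ w₃ : ℝ) (hw₁ : 0 < w₁) (hw₂ : 0 < w₂) (hm₁ : (J 0 0 * v₁ 1 ^ 2 + J 1 1 * v₁ 0 ^ 2 - (J 0 1 + J 1 0) * (v₁ 0 * v₁ 1)) < 0) (hv12 : v₁ 0 * v₂ 1 - v₁ 1 * v₂ 0 ≠ 0)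
    (hS : (J 0 0 * v₁ 1 ^ 2 + J 1 1 * v₁ 0 ^ 2 - (J 0 1 + J 1 0) * (v₁ 0 * v₁ 1)) * (J 0 0 * v₂ 1 ^ 2 + J 1 1 * v₂ 0 ^ 2 - (J 0 1 + J 1 0) * (v₂ 0 * v₂ 1))
        * (((d₁ : ℝ) - d₀) * ((d₃ : ℝ) - d₁) * ((e : ℝ) - d₀) * ((e : ℝ) + d₁ - d₀ - d₂) * ((d₀ : ℝ) + d₃ - e - d₁) * ((d₃ : ℝ) - e) * ((d₂ : ℝ) + d₃ - e - d₁))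
        * (((d₂ : ℝ) - d₀) * ((d₃ : ℝ) - d₂) * ((e : ℝ) + d₂ - d₀ - d₁) * ((e : ℝ) - d₀) * ((e : ℝ) + d₂ - d₀ - d₃) * ((d₁ : ℝ) + d₃ - e - d₂) * ((d₃ : ℝ) - e))
        ≤ (-J.det) * ((v₁ 0 * v₂ 1 - v₁ 1 * v₂ 0) ^ 2)
        * (((e : ℝ) - d₀) * ((d₃ : ℝ) - e) * ((2 : ℝ) * e - d₀ - d₁) * ((d₀ : ℝ) + d₂ - 2 * e) * ((d₀ : ℝ) + d₃ - 2 * e) * ((d₁ : ℝ) + d₃ - 2 * e) * ((d₂ : ℝ) + d₃ - 2 * e))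
        * (((d₁ : ℝ) + d₂ - e - d₀) * ((e : ℝ) + d₃ - d₁ - d₂) * ((d₂ : ℝ) - d₀) * ((d₁ : ℝ) - d₀) * ((d₁ : ℝ) + d₂ - d₀ - d₃) * ((d₃ : ℝ) - d₂) * ((d₃ : ℝ) - d₁))) :
    ((Matrix.det (((X : ℝ[X]) ^ e) • J.map Polynomial.C
        + (Polynomial.C w₀ * X ^ d₀) • (vecMulVec v₀ v₀).map Polynomial.C
        + (Polynomial.C w₁ * X ^ d₁) • (vecMulVec v₁ v₁).map Polynomial.C
        + (Polynomial.C w₂ * X ^ d₂) • (vecMulVec v₂ v₂).map Polynomial.C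
        + (Polynomial.C w₃ * X ^ d₃) • (vecMulVec v₃ v₃).map Polynomial.C)).roots.toFinset.filter (fun t => 0 < t)).card
      ≤ 8 := by
  rw [det_rankOne_four_sum]
  exact elevenNomial_oneThree_T12_le_eight e d₀ d₁ d₂ d₃ h0e he1 h12 h23 hC3 hC4 hC5 hC6 J.det _ _ _ _ w₀ w₁ w₂ w₃ _ _ _ _ _ _
    hw₁ hw₂ hm₁ (by positivity) hS

end Summit.ValiantsHypothesis.ValiantsHypothesis.Theorems.LacunarySymmetroidMatrixDescartes.Pivot.TwoDirections.BlockLaw
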